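import Summits.Schanuel.Schanuel.Theorems.DiophantineDichotomyKhovanskiiApproxTypeEvLinearFormCertificate
import Summits.Schanuel.Schanuel.Theorems.DiophantineDichotomyKhovanskiiApproxTypeEvOrderDefectPrint
import HarnessLib

/-!
# The linear-form certificate with the print exponent `κ = n` (`linearFormCertificate_print`)

Line `Sketch` of crux `DiophantineDichotomy.KhovanskiiApproxTypeEv` (stmt-Schanuel-14972), skeleton v13
(lead `prover-line-stmt-Schanuel-14972-c13-0`) — `--supports`.

Composition of the two landed sub-goals of the line that concern the strategist's order-defect input M2 of
leaf B (STRATEGY-CENSUS §7, `Cruxes/KhovanskiiApproxTypeEv/SketchIdea.lean`): sub-goal F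
`stub_orderDefectMeasurePrint` (M2 with the print exponent `κ = n`, Ably 1994 at `m = n`, p150635) and sub-goal G
`stub_linearFormCertificate` (`OrderDefectMeasure n κ → LinearFormCertificate n κ`, unfolded, p154225).  Result:
`LinearFormCertificate n n` of `SketchIdea.lean`, unfolded, UNCONDITIONALLY — at every Lindemann–Weierstrass point
`θ = (s, e^s)` of rank `n ≥ 1`, a challenger within distance `1` of `θ` whose `y`-coordinates sum exactly to a root
of a non-zero `P ∈ ℤ[x]` of degree `≤ D` and naive height `≤ H` stays at distance
`≥ exp(−C Dⁿ log H) / (n (D+1) H (2 + ‖e^s‖)^D)` past a threshold `H₀(D)`.  Leaf B at rank 3 (naive LW layer)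
would need the same certificate with an exponent `< 5/2` in place of `3` against the `S_k`-sum species
(STRATEGY-CENSUS §7.1); that sharpening is not in print.  Everything here is proved; no named facts.
-/

noncomputable section

set_option linter.dupNamespace false -- mandated summit/sub-problem namespace (single-conjunct summit)

namespace Summit.Schanuel.Schanuel.Cruxes.KhovanskiiApproxTypeEv.AnchoredReduction

/-- **The linear-form certificate HOLDS with `κ = n`, unconditionally** (`LinearFormCertificate n n` of
`Cruxes/KhovanskiiApproxTypeEv/SketchIdea.lean`, unfolded; composition of sub-goal G `stub_linearFormCertificate`,
p154225, with the print baseline F `stub_orderDefectMeasurePrint`, p150635): at every LW point of rank `n ≥ 1`, a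
challenger within distance `1` whose `y`-coordinates sum exactly to a root of a non-zero `P ∈ ℤ[x]` of degree
`≤ D` and height `≤ H` stays at distance `≥ exp(−C Dⁿ log H)/(n (D+1) H (2 + ‖e^s‖)^D)` past a threshold `H₀(D)`.
[folklore] -/
theorem linearFormCertificate_print (n : ℕ) (hn : 1 ≤ n)
    (s : Fin n → ℂ) (halg : ∀ j, IsAlgebraic ℚ (s j)) (hli : LinearIndependent ℚ s) :
    ∃ C : ℝ, 0 < C ∧ ∀ D : ℕ, ∃ H₀ : ℕ, ∀ (H : ℕ) (γ : Fin n ⊕ Fin n → ℂ) (P : Polynomial ℤ),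
      H₀ ≤ H → P ≠ 0 → P.natDegree ≤ D → (∀ k, |P.coeff k| ≤ (H : ℤ)) →
      Polynomial.aeval (∑ j, γ (Sum.inr j)) P = 0 → ‖γ - Sum.elim s (Complex.exp ∘ s)‖ ≤ 1 →
        Real.exp (-(C * (D : ℝ) ^ (n : ℝ) * Real.log H)) /
            (n * (D + 1) * H * (2 + ‖Complex.exp ∘ s‖) ^ D)
          ≤ ‖γ - Sum.elim s (Complex.exp ∘ s)‖ :=
  stub_linearFormCertificate n n (fun β hβ hβli => stub_orderDefectMeasurePrint n hn β hβ hβli) s halg hli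

/-- The rank-3 instance, where leaf B of the crux lives: the linear-form certificate at every LW triple with the
print exponent `3` (leaf B wants `< 5/2`). [folklore] -/
theorem linearFormCertificate_print_three
    (s : Fin 3 → ℂ) (halg : ∀ j, IsAlgebraic ℚ (s j)) (hli : LinearIndependent ℚ s) :
    ∃ C : ℝ, 0 < C ∧ ∀ D : ℕ, ∃ H₀ : ℕ, ∀ (H : ℕ) (γ : Fin 3 ⊕ Fin 3 → ℂ) (P : Polynomial ℤ),
      H₀ ≤ H → P ≠ 0 → P.natDegree ≤ D → (∀ k, |P.coeff k| ≤ (H : ℤ)) →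
      Polynomial.aeval (∑ j, γ (Sum.inr j)) P = 0 → ‖γ - Sum.elim s (Complex.exp ∘ s)‖ ≤ 1 →
        Real.exp (-(C * (D : ℝ) ^ (3 : ℝ) * Real.log H)) /
            (3 * (D + 1) * H * (2 + ‖Complex.exp ∘ s‖) ^ D)
          ≤ ‖γ - Sum.elim s (Complex.exp ∘ s)‖ := by
  have h := linearFormCertificate_print 3 (by norm_num) s halg hli
  norm_num at h ⊢
  exact h

end Summit.Schanuel.Schanuel.Cruxes.KhovanskiiApproxTypeEv.AnchoredReduction

end
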